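import Literature.Computability.FineGrained.KSumETHCore
import Literature.Computability.FineGrained.CliqueETHMachineModel
import Literature.Computability.FineGrained.SparsificationAlgorithm
import HarnessLib

/-!
# ETH-hardness of `k`-SUM (Pătraşcu–Williams 2010, Cor. 5.1): the assembly

Pătraşcu–Williams, *On the possibility of faster SAT algorithms*, SODA 2010, §5, Cor. 5.1
(p. 1072): "If `d`-SUM over `N` numbers of `O(d lg N)` bits can be solved in `N^{o(d)}` time, then
3-SAT on `n` variables can be solved in `2^{o(n)}` time." The tree states this as the named fact
`Literature.Computability.FineGrained.not_eth_of_kSUM_subpoly` (`Conjectures.lean`): an exponent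
function `g` with `g(k)/k → 0` and deterministic word-RAM algorithms for `kSUM k` (entries in
`[-N^k, N^k]`) in time `O(N^{g(k)})` for every `k ≥ 3` refute Wave0's (multi-stack Turing machine)
`ETH`.

This file assembles the fact from the tree's proved infrastructure, leaving exactly ONE proof
obligation, the word-RAM reduction program (the analogue for `k`-SUM of
`liberalSparseKSATInRAMTime_of_kCliqueInTimeNLittleOK_holds`, `CliqueETHLiberalReduction.lean`):

* `KSumRed.outputsWithin_ksumList_of_inTimeO` — what a hypothetical `kSUM K` program does on the
  reduction instance `ksumList φ K` of `KSumETHCore.lean` (`hasKSum_ksumList_iff`): at word size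
  `k' · size (max N (2 D₀))` (`inputWidth_ksumList`) it outputs `[1]`/`[0]` according to the
  satisfiability of `φ`, within `⌊C · t(N) + C⌋₊` steps;
* `KSumRed.N_real_le` — the length of the list for a sparse formula (`m ≤ c n` clauses):
  `N ≤ (K + 4 (K+1)²) · 2^{(1 + 10 c)(n/K + 1)}`;
* `eventually_forall_ksum_time_le` — the choice of `K`: if `g(k)/k → 0` then for all large `k`,
  every constant `C` and all `n`, `N` with `N ≤ B(k) · 2^{a (n/k + 1)}`,
  `⌊C · N^{g(k)} + C⌋₊ ≤ C₁ · 2^{δ n}` (the `InTimeO` form of `eventually_forall_clique_time_le` of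
  `CliqueETH.lean`, with an arbitrary coefficient `B(k) ≥ 1` in place of `k`);
* **`not_eth_of_kSUM_subpoly_of_liberal`** — the assembly (proved): if the `k`-SUM hypothesis of
  the fact yields, for every density `c` and every `δ > 0`, a liberal word-RAM decider of sparse
  3-SAT in time `O(2^{δ n})` (`LiberalSparseKSATInRAMTime 3 c δ`, `CliqueETHTMBridge.lean`), then
  `not_eth_of_kSUM_subpoly` holds — by the proved sparsification lemma on Turing machines
  (`sparsification_holds`, `kSATInExpTime_of_sparseKSATInExpTime`: Impagliazzo–Paturi–Zane,
  Cor. 1–2) and the proved change of machine model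
  (`sparseKSATInExpTime_of_liberalSparseKSATInRAMTime_holds`: Cook–Reckhow simulation), exactly as
  `not_kClique_inTimeInst_of_eth_of_tm` assembles the Chen–Huang–Kanj–Xia theorem.

## What remains for `not_eth_of_kSUM_subpoly_holds` (plan; no named fact is or may be introduced)

The hypothesis `hred` of `not_eth_of_kSUM_subpoly_of_liberal`, i.e. a theorem

  `liberalSparseKSATInRAMTime_of_kSUM_subpoly :
    (∃ g, Tendsto (fun k => g k / k) atTop (𝓝 0) ∧ ∀ k, 3 ≤ k → (kSUM k).InTimeO (· ^ g k)) →
      ∀ c δ, 0 < δ → LiberalSparseKSATInRAMTime 3 c δ`,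

proved like `liberalSparseKSATInRAMTime_of_kCliqueInTimeNLittleOK_holds` /
`sparseKSATInRAMTime_of_kCliqueInTimeNLittleOK_holds` (`CliqueETHGroupingReduction.lean`), from a
structured word-RAM program (`SProg`, logic `SProg.Achieves`, one emulated run `SProg.withSubrun`,
template `CliqueETHReductionProgram.lean`) that, on `x = encodeCNFWords φ`
(`x[0] = n`, `x[1] = m`, then the clauses) and at any word size `W` with `Fits W`:
(1) relocates the input and computes `nAll = n + 6m`, `s = bs = ⌈nAll/K⌉`, `2^s`, `t = bt`,
`P = 4(K+1)² 2^t`, `N = K 2^s + P`, `F = 2^{10 m}`, `BK = (K+1)^K`, `highX = (F-1)/3`,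
`Xt = lowX + BK · highX`, `R = BK · F`, `D₀ = (K+1) K R + 1`, the emulated word size
`ws = k' · size (max N (2 D₀))` by the halving loop, `2^ws` and the emulator environment
(cf. `CliqueRed.setup1/sizeLoop/setup3`); (2) fills the slot tables of the clauses
(`CliqueRed.tables` pattern; `KSumRed.gposLit` reads slots through `CliqueRed.litAt`); (3) for
`i < K`, `μ < 2^s` accumulates `high φ K i μ = ∑_j cnt · 4^j` over the `5 m` constraints (the 15
gadget positions unrolled; `posBit` = block test `i s ≤ v < i s + s` and bit `(μ >> (v - i s)) & 1`
against the polarity), forms `val = (K+1)^i + BK · high` and the zig-zag code `ycode φ K i μ`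
(`encodeInt_yval`) and stores it in emulated input cell `1 + i 2^s + μ`; (4) stores the dummy
code `2 D₀` in the remaining `P` cells and the length `N` in emulated cell `0` (this is
`init ws (encodeIntList (ksumList φ K))`, `getElem_ksumList`, `entry`); (5) runs the `kSUM K`
program by `withSubrun` and copies its answer bit (`CliqueRed.post` pattern). Every address and
value of the run — the largest is the emulated modulus `2^{ws}`,
`ws = k' · size (max N (2 D₀)) = O_K(k' (n + m))` (`2 D₀ < 2^{10 m + (K+2) size (K+1) + 2}`,
`N ≤ (K + 4 (K+1)²) · 2^{max s t}`, `max s t ≤ n + 10 m`) — is `< 2^W` once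
`W ≥ kfit · (n + inputWidth x)` with `kfit = Θ_K(k' (c + 1))` (pattern `CliqueRed.Params.kfit` /
`fits` / `Fits.mono`, using `m ≤ c n`; `k' = 0` is contradictory for a `kSUM K` decider, `K ≥ 2`,
since at word size `0` the run does not depend on the input, pattern `DedupWrap.kM_pos_sparse`);
the build costs `O_K(N · m + |x|) = O_K(2^{(1+10c)(n/K+1)} · n)` steps, `≤ C_b 2^{(δ/2) n}` for
`4 (1 + 10 c) ≤ δ K` (pattern `Tpre_real_le` with `exists_sq_le_two_rpow`), and the emulated run
costs `cstep · ⌊C_K N^{g K} + C_K⌋₊ + 4 ≤ 38 C₁ 2^{(δ/2) n} + 4` by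
`eventually_forall_ksum_time_le` (`B K = K + 4 (K+1)²`, `a = 1 + 10 c`, target `δ/2`) and
`KSumRed.N_real_le`; `K` is taken `≥ 3` from the three eventual conditions, then `C_K, M_K, k'_K`
from the hypothesis at `K` through `KSumRed.outputsWithin_ksumList_of_inTimeO`. Then
`theorem not_eth_of_kSUM_subpoly_holds : not_eth_of_kSUM_subpoly :=
  not_eth_of_kSUM_subpoly_of_liberal liberalSparseKSATInRAMTime_of_kSUM_subpoly`
in the file proving the reduction (which imports this one).

## References

* M. Pătraşcu, R. Williams, *On the possibility of faster SAT algorithms*, Proc. SODA 2010,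
  1065–1075, §5: Thm. 5.1, Cor. 5.1 and the proof of Thm. 5.1 (pp. 1072–1073).
* R. Impagliazzo, R. Paturi, F. Zane, *Which problems have strongly exponential complexity?*,
  JCSS 63 (2001), §2, Thm. 1, Cor. 1–2.
* S. A. Cook, R. A. Reckhow, *Time bounded random access machines*, JCSS 7 (1973), §2.
-/

namespace Literature.Computability.FineGrained

open Filter Topology Cryptography Cryptography.WordRAM Complexity

namespace KSumRed

/-! ### What a hypothetical `kSUM K` program does on the reduction instance -/

open scoped Classical in
/-- A deterministic word-RAM program solving `kSUM K` in time `O(t(N))` decides, when run on the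
encoding `encodeIntList (ksumList φ K)` of the reduction instance (`K ≥ 2`, width `≤ 3`) at word
size `k' · size (max N (2 D₀))`, the satisfiability of `φ`: it outputs `[1]` if `φ` is satisfiable
and `[0]` otherwise, within `⌊C · t(N) + C⌋₊` steps (`kSUM_good_ksumInst`, `kSUM_width_ksumInst`).
[cite: PatrascuWilliams2010, proof of Thm. 5.1] -/
theorem outputsWithin_ksumList_of_inTimeO {K : ℕ} (hK : 2 ≤ K) {t : ℕ → ℝ}
    (h : (kSUM K).InTimeO t) :
    ∃ (C : ℝ) (M : Program) (kM : ℕ), M.IsDeterministic ∧ M.IsOracleFree ∧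
      ∀ φ : CNF ℕ, φ.IsWidthLE 3 →
        OutputsWithin M (kM * Nat.size (max (N φ K) (2 * D0 φ K))) noOracle zeroCoins
          (encodeIntList (ksumList φ K)) [if φ.Satisfiable then 1 else 0]
          ⌊C * t (N φ K) + C⌋₊ := by
  obtain ⟨C, M, kM, hdet, hof, hM⟩ := h
  refine ⟨C, M, kM, hdet, hof, fun φ hw => ?_⟩
  obtain ⟨out, hout, hrun⟩ := hM (ksumInst φ hK)
  have hout' : out = [if φ.Satisfiable then 1 else 0] := (kSUM_good_ksumInst hK hw out).1 hout
  subst hout'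
  have h2 : OutputsWithin M (kM * (kSUM K).width (ksumInst φ hK)) noOracle zeroCoins
      ((kSUM K).encode (ksumInst φ hK)) [if φ.Satisfiable then 1 else 0]
      ⌊C * t ((kSUM K).size (ksumInst φ hK)) + C⌋₊ := hrun
  rwa [kSUM_width_ksumInst, kSUM_size_ksumInst, kSUM_encode_ksumInst] at h2

/-! ### The length of the list for a sparse formula -/

/-- A natural-number power of two as a real power. [folklore] -/
theorem cast_two_pow_eq_rpow (e : ℕ) : ((2 ^ e : ℕ) : ℝ) = (2 : ℝ) ^ (e : ℝ) := by
  rw [Real.rpow_natCast]; push_cast; ring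

/-- A ceiling block length in real terms: `blockLen M K ≤ M / K + 1`. [folklore] -/
theorem blockLen_real_le (M : ℕ) {K : ℕ} (hK : 1 ≤ K) :
    (blockLen M K : ℝ) ≤ (M : ℝ) / K + 1 := by
  have h1 : blockLen M K ≤ M / K + 1 := blockLen_le M hK
  calc (blockLen M K : ℝ) ≤ ((M / K : ℕ) : ℝ) + 1 := by exact_mod_cast h1
    _ ≤ (M : ℝ) / K + 1 := by gcongr; exact Nat.cast_div_le

/-- **The length of the `K`-SUM list of a sparse formula**: for `K ≥ 1` and `m ≤ c n` clauses
(`n = numVars φ`), `N = K · 2^{⌈(n + 6m)/K⌉} + 4 (K+1)² · 2^{⌈10 m / K⌉}` is at most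
`(K + 4 (K+1)²) · 2^{(1 + 10 c)(n/K + 1)}`. [folklore] -/
theorem N_real_le (φ : CNF ℕ) {K : ℕ} (hK : 1 ≤ K) {c : ℕ} (hc : φ.length ≤ c * φ.numVars) :
    (N φ K : ℝ) ≤ ((K : ℝ) + 4 * ((K : ℝ) + 1) ^ 2) *
      (2 : ℝ) ^ ((1 + 10 * (c : ℝ)) * ((φ.numVars : ℝ) / K + 1)) := by
  set n := φ.numVars with hn
  set m := φ.length with hm
  set E : ℝ := (1 + 10 * (c : ℝ)) * ((n : ℝ) / K + 1) with hE
  have hK0 : (0 : ℝ) < K := by exact_mod_cast hK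
  have hn0 : (0 : ℝ) ≤ (n : ℝ) / K := by positivity
  have hc0 : (0 : ℝ) ≤ (c : ℝ) := Nat.cast_nonneg _
  have hmR : (m : ℝ) ≤ c * n := by exact_mod_cast hc
  -- the two exponents are at most `E`
  have hbs : (bs φ K : ℝ) ≤ E := by
    have h1 : (bs φ K : ℝ) ≤ ((nAll φ : ℕ) : ℝ) / K + 1 := blockLen_real_le _ hK
    have h2 : ((nAll φ : ℕ) : ℝ) ≤ (1 + 6 * (c : ℝ)) * n := by
      unfold nAll; push_cast; nlinarith
    calc (bs φ K : ℝ) ≤ ((nAll φ : ℕ) : ℝ) / K + 1 := h1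
      _ ≤ (1 + 6 * (c : ℝ)) * n / K + 1 := by gcongr
      _ = (1 + 6 * (c : ℝ)) * ((n : ℝ) / K) + 1 := by ring
      _ ≤ (1 + 10 * (c : ℝ)) * ((n : ℝ) / K) + (1 + 10 * (c : ℝ)) * 1 := by nlinarith
      _ = E := by rw [hE]; ring
  have hbt : (bt φ K : ℝ) ≤ E := by
    have h1 : (bt φ K : ℝ) ≤ ((10 * φ.length : ℕ) : ℝ) / K + 1 := blockLen_real_le _ hK
    have h2 : ((10 * φ.length : ℕ) : ℝ) ≤ 10 * (c : ℝ) * n := by push_cast; nlinarith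
    calc (bt φ K : ℝ) ≤ ((10 * φ.length : ℕ) : ℝ) / K + 1 := h1
      _ ≤ 10 * (c : ℝ) * n / K + 1 := by gcongr
      _ = 10 * (c : ℝ) * ((n : ℝ) / K) + 1 := by ring
      _ ≤ (1 + 10 * (c : ℝ)) * ((n : ℝ) / K) + (1 + 10 * (c : ℝ)) * 1 := by nlinarith
      _ = E := by rw [hE]; ring
  have hmask : (nMask φ K : ℝ) ≤ (2 : ℝ) ^ E := by
    unfold nMask
    rw [cast_two_pow_eq_rpow]
    exact Real.rpow_le_rpow_of_exponent_le one_le_two hbs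
  have hpad : ((2 ^ bt φ K : ℕ) : ℝ) ≤ (2 : ℝ) ^ E := by
    rw [cast_two_pow_eq_rpow]
    exact Real.rpow_le_rpow_of_exponent_le one_le_two hbt
  have hpow : (0 : ℝ) ≤ (2 : ℝ) ^ E := by positivity
  have hN : (N φ K : ℝ) = K * (nMask φ K : ℝ) + 4 * ((K : ℝ) + 1) ^ 2 * ((2 ^ bt φ K : ℕ) : ℝ) := by
    unfold N P; push_cast; ring
  rw [hN]
  calc (K : ℝ) * (nMask φ K : ℝ) + 4 * ((K : ℝ) + 1) ^ 2 * ((2 ^ bt φ K : ℕ) : ℝ)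
      ≤ (K : ℝ) * (2 : ℝ) ^ E + 4 * ((K : ℝ) + 1) ^ 2 * (2 : ℝ) ^ E := by gcongr
    _ = ((K : ℝ) + 4 * ((K : ℝ) + 1) ^ 2) * (2 : ℝ) ^ E := by ring

end KSumRed

/-! ### Exponent bookkeeping: one fixed `K` per target exponent `δ` -/

/-- **The choice of `K`.** If `g(k)/k → 0` then for every growth constant `a ≥ 0`, every
coefficient function `B ≥ 1` and every target exponent `δ > 0`, all sufficiently large `k` have
the property: for every constant `C` there is `C₁ ≥ 0` with `⌊C · N^{g(k)} + C⌋₊ ≤ C₁ · 2^{δ n}`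
whenever `N ≤ B(k) · 2^{a (n/k + 1)}` — the running time `O(N^{g(k)})` of the hypothetical `k`-SUM
algorithm on the reduction instances (`KSumRed.N_real_le`: `B(k) = k + 4 (k+1)²`, `a = 1 + 10 c`)
is `O_k(2^{δ n})`. (Pătraşcu–Williams 2010, proof of Thm. 5.1, run with one fixed `d = k`; the
`InTimeO` form of `eventually_forall_clique_time_le`.) [folklore] -/
theorem eventually_forall_ksum_time_le (B : ℕ → ℝ) (hB : ∀ k, 1 ≤ B k) {g : ℕ → ℝ}
    (hg : Tendsto (fun k => g k / k) atTop (𝓝 0)) {a δ : ℝ} (ha : 0 ≤ a) (hδ : 0 < δ) :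
    ∀ᶠ k : ℕ in atTop, ∀ C : ℝ, ∃ C₁ : ℝ, 0 ≤ C₁ ∧ ∀ n N : ℕ,
      (N : ℝ) ≤ B k * (2 : ℝ) ^ (a * ((n : ℝ) / k + 1)) →
        ((⌊C * (N : ℝ) ^ g k + C⌋₊ : ℕ) : ℝ) ≤ C₁ * (2 : ℝ) ^ (δ * n) := by
  -- eventually `g k / k < δ / (a + 1)` and `1 ≤ k`
  have hε : 0 < δ / (a + 1) := div_pos hδ (by linarith)
  have h1 : ∀ᶠ k : ℕ in atTop, g k / k < δ / (a + 1) := hg.eventually (Iio_mem_nhds hε)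
  have h2 : ∀ᶠ k : ℕ in atTop, 1 ≤ k := eventually_ge_atTop 1
  filter_upwards [h1, h2] with k hk hk1 C
  have hkpos : (0 : ℝ) < k := by exact_mod_cast hk1
  have hB1 : 1 ≤ B k := hB k
  have hB0 : 0 < B k := by linarith
  -- the nonnegative part of the exponent
  set γ : ℝ := max (g k) 0 with hγ
  have hγ0 : 0 ≤ γ := le_max_right _ _
  have hγk : a * γ / k ≤ δ := by
    have hgk : g k / k < δ / (a + 1) := hk
    have hγk' : γ / k ≤ δ / (a + 1) := by
      rcases le_total (g k) 0 with hle | hle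
      · have : γ = 0 := by rw [hγ, max_eq_right hle]
        rw [this, zero_div]; exact hε.le
      · have : γ = g k := by rw [hγ, max_eq_left hle]
        rw [this]; exact hgk.le
    calc a * γ / k = a * (γ / k) := by ring
      _ ≤ a * (δ / (a + 1)) := mul_le_mul_of_nonneg_left hγk' ha
      _ ≤ δ := by
          rw [mul_div_assoc']
          rw [div_le_iff₀ (by linarith)]
          nlinarith
  -- the constants
  set C' : ℝ := max C 0 with hC'
  have hC'0 : 0 ≤ C' := le_max_right _ _
  refine ⟨C' * ((B k) ^ γ * (2 : ℝ) ^ (a * γ) + 1), by positivity, fun n N hN => ?_⟩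
  have hN0 : (0 : ℝ) ≤ N := Nat.cast_nonneg _
  have hpow2 : (0 : ℝ) < (2 : ℝ) ^ (δ * n) := by positivity
  have hone : (1 : ℝ) ≤ (2 : ℝ) ^ (δ * n) :=
    Real.one_le_rpow (by norm_num) (by positivity)
  -- `N ^ g k ≤ N ^ γ ≤ (B k · 2^{a(n/k+1)}) ^ γ = (B k)^γ 2^{aγ} 2^{(aγ/k) n} ≤ (B k)^γ 2^{aγ} 2^{δ n}`
  have hbase : (0 : ℝ) ≤ B k * (2 : ℝ) ^ (a * ((n : ℝ) / k + 1)) := by positivity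
  have hNg : (N : ℝ) ^ g k ≤ (B k) ^ γ * (2 : ℝ) ^ (a * γ) * (2 : ℝ) ^ (δ * n) := by
    rcases Nat.eq_zero_or_pos N with hN0' | hNpos
    · subst hN0'
      rcases eq_or_ne (g k) 0 with hg0 | hg0
      · rw [hg0, Nat.cast_zero, Real.rpow_zero]
        have : (1 : ℝ) ≤ (B k) ^ γ * (2 : ℝ) ^ (a * γ) :=
          one_le_mul_of_one_le_of_one_le (Real.one_le_rpow hB1 hγ0)
            (Real.one_le_rpow (by norm_num) (by positivity))
        nlinarith
      · rw [Nat.cast_zero, Real.zero_rpow hg0]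
        positivity
    · have hN1 : (1 : ℝ) ≤ N := by exact_mod_cast hNpos
      calc (N : ℝ) ^ g k ≤ (N : ℝ) ^ γ := Real.rpow_le_rpow_of_exponent_le hN1 (le_max_left _ _)
        _ ≤ (B k * (2 : ℝ) ^ (a * ((n : ℝ) / k + 1))) ^ γ := Real.rpow_le_rpow hN0 hN hγ0
        _ = (B k) ^ γ * (2 : ℝ) ^ (a * γ) * (2 : ℝ) ^ ((a * γ / k) * n) := by
            rw [Real.mul_rpow hB0.le (by positivity), ← Real.rpow_mul (by norm_num)]
            rw [show a * ((n : ℝ) / k + 1) * γ = a * γ + (a * γ / k) * n by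
              field_simp; ring]
            rw [Real.rpow_add (by norm_num)]
            ring
        _ ≤ (B k) ^ γ * (2 : ℝ) ^ (a * γ) * (2 : ℝ) ^ (δ * n) := by
            apply mul_le_mul_of_nonneg_left _ (by positivity)
            exact Real.rpow_le_rpow_of_exponent_le (by norm_num)
              (mul_le_mul_of_nonneg_right hγk (Nat.cast_nonneg _))
  -- floors and the final estimate
  have hNg0 : (0 : ℝ) ≤ (N : ℝ) ^ g k := Real.rpow_nonneg hN0 _
  have hfl : ((⌊C * (N : ℝ) ^ g k + C⌋₊ : ℕ) : ℝ) ≤ C' * (N : ℝ) ^ g k + C' := by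
    have h1 : C * (N : ℝ) ^ g k + C ≤ C' * (N : ℝ) ^ g k + C' :=
      add_le_add (mul_le_mul_of_nonneg_right (le_max_left _ _) hNg0) (le_max_left _ _)
    exact (Nat.cast_le.2 (Nat.floor_le_floor h1)).trans (Nat.floor_le (by positivity))
  calc ((⌊C * (N : ℝ) ^ g k + C⌋₊ : ℕ) : ℝ) ≤ C' * (N : ℝ) ^ g k + C' := hfl
    _ ≤ C' * ((B k) ^ γ * (2 : ℝ) ^ (a * γ) * (2 : ℝ) ^ (δ * n)) + C' * (2 : ℝ) ^ (δ * n) := by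
        have h38 : C' ≤ C' * (2 : ℝ) ^ (δ * n) := le_mul_of_one_le_right hC'0 hone
        have h39 : C' * (N : ℝ) ^ g k ≤ C' * ((B k) ^ γ * (2 : ℝ) ^ (a * γ) * (2 : ℝ) ^ (δ * n)) :=
          mul_le_mul_of_nonneg_left hNg hC'0
        linarith
    _ = C' * ((B k) ^ γ * (2 : ℝ) ^ (a * γ) + 1) * (2 : ℝ) ^ (δ * n) := by ring

/-! ### The assembly -/

/-- **Pătraşcu–Williams, Cor. 5.1, assembled down to the word-RAM reduction (proved).** If the
hypothesis of `not_eth_of_kSUM_subpoly` — an exponent function `g` with `g(k)/k → 0` and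
deterministic word-RAM algorithms for `kSUM k` in time `O(N^{g(k)})` for every `k ≥ 3` — yields,
for every density `c` and every `δ > 0`, a liberal word-RAM decider of the width-`≤ 3` clause
lists with `≤ c n` clauses in time `O(2^{δ n})` (`LiberalSparseKSATInRAMTime 3 c δ`; this is the
reduction in the proof of Thm. 5.1, to be established from `KSumETHCore.lean` as described in the
module docstring), then `not_eth_of_kSUM_subpoly` holds: under `ETH` pick `δ > 0` with
`¬ KSATInExpTime 3 δ`; the liberal deciders give sparse 3-SAT on multi-stack Turing machines for
all densities and exponents (`sparseKSATInExpTime_of_liberalSparseKSATInRAMTime_holds`), hence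
`KSATInExpTime 3 δ` by the sparsification lemma (`kSATInExpTime_of_sparseKSATInExpTime
sparsification_holds`). [cite: PatrascuWilliams2010, Cor. 5.1] -/
theorem not_eth_of_kSUM_subpoly_of_liberal
    (hred : (∃ g : ℕ → ℝ, Tendsto (fun k => g k / k) atTop (𝓝 0) ∧
        ∀ k, 3 ≤ k → (kSUM k).InTimeO fun n => (n : ℝ) ^ g k) →
      ∀ (c : ℕ) (δ : ℝ), 0 < δ → LiberalSparseKSATInRAMTime 3 c δ) :
    not_eth_of_kSUM_subpoly := by
  rintro hsum ⟨δ, hδ, hnot⟩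
  exact hnot (kSATInExpTime_of_sparseKSATInExpTime sparsification_holds
    (fun c δ' hδ' => sparseKSATInExpTime_of_liberalSparseKSATInRAMTime_holds 3 c (by norm_num)
      (hred hsum) δ' hδ') δ hδ)

/-- The same assembly read as a refutation of ETH: the word-RAM reduction and the `k`-SUM
hypothesis put 3-SAT in `TIME(2^{δ n} · poly(L))` on multi-stack Turing machines for every
`δ > 0`. [cite: PatrascuWilliams2010, Cor. 5.1] -/
theorem kSATInExpTime_three_of_kSUM_subpoly_of_liberal
    (hred : (∃ g : ℕ → ℝ, Tendsto (fun k => g k / k) atTop (𝓝 0) ∧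
        ∀ k, 3 ≤ k → (kSUM k).InTimeO fun n => (n : ℝ) ^ g k) →
      ∀ (c : ℕ) (δ : ℝ), 0 < δ → LiberalSparseKSATInRAMTime 3 c δ)
    (hsum : ∃ g : ℕ → ℝ, Tendsto (fun k => g k / k) atTop (𝓝 0) ∧
        ∀ k, 3 ≤ k → (kSUM k).InTimeO fun n => (n : ℝ) ^ g k)
    (δ : ℝ) (hδ : 0 < δ) : KSATInExpTime 3 δ :=
  kSATInExpTime_of_sparseKSATInExpTime sparsification_holds
    (fun c δ' hδ' => sparseKSATInExpTime_of_liberalSparseKSATInRAMTime_holds 3 c (by norm_num)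
      (hred hsum) δ' hδ') δ hδ

end Literature.Computability.FineGrained
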